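import Summits.QuantumFields.YangMills.Theorems.IR.ShellMaxCorrEngine
import Summits.QuantumFields.YangMills.Theorems.IR.CollarDecouplingCriterion
import Summits.QuantumFields.YangMills.Theorems.IR.ShellMaxCorrRung
import Summits.QuantumFields.YangMills.Theorems.IR.CollarDecouplingRungSC
import HarnessLib

/-!
# Crux `IR` (stmt-QuantumFields-19354) — LINE «shell-maxcorr-doubling» (ideator ym-ir-idea-1 g0, lens: transfer of
our connectivity-gluing inequalities (CSH / Kesten–Nguyen annulus crossing, RSW) to the 4D lattice gauge field)

**Dictionary (the transfer, explicit).**  «probability that an annulus `B_{R+s} \ B_R` is crossed by an open path»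
↦ `Ψ_β(s)` := the MAXIMAL CORRELATION between the σ-algebra of the links inside the sup-ball `B_R` and the
σ-algebra of the links outside `B_{R+s}` of the torus Wilson measure, `sup` over the radius `R`;  «independent
crossings of disjoint annuli multiply (BK / Markov)» ↦ the Markov property of the nearest-neighbour plaquette
action across one link layer + the Hilbert-space product bound `ρ(𝒜,𝒞) ≤ ρ(𝒜,ℳ)·ρ(ℳ,𝒞)` for `𝒜 ⊥ 𝒞 ∣ ℳ`;
«RSW: a crossing probability bounded AWAY FROM ONE at one scale forces exponential decay» ↦ the doubling law
`Ψ(2s+1) ≤ Ψ(s)²`, hence `Ψ(s₀) ≤ θ < 1` at ONE shell thickness `s₀ = ⌈K₀/a(β)⌉` gives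
`Ψ(t) ≤ θ^{(t+1)/(2s₀+2)}`, i.e. `GapInUnits` with rate `c₁ ≈ |log θ|/(2K₀)` for EVERY pair of local species at once.

**Why this line.**  Every certificate on the IR desk (8895 DS/TV, L2″ outer-tempered, tensorisation `TensorizesAt`)
needs a SMALL parameter at the certifying scale (`ε·M < 1`, `C = O(1)` per block chain).  The annulus-crossing
transfer needs only `θ < 1` — «the far field does not determine the near field perfectly across one physical shell» —
because the gluing squares the bound under doubling.  Balls never wrap the torus, so the certificate is blind to the
light flux sectors that bite torus-global L² formats (`gapAtCorrelationLength_false_of_lightFluxMode_SO3`); it has no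
boundary datum (immune to the v6–v8 locality defect and the wire/film witnesses); it uses no positivity
(`Literature.Barriers.QuantumFields.ToronPlaneAnticorrelation` does not quantify over it); it never mentions the centre
(IR ranges over centreless simple `G`).  The time-SLAB analogue would be the transfer-matrix norm — a tautology and
flux-bitten — and is deliberately NOT used.

**Why novel vs listed lines/cards.**  birth v10 (`IROuterCertificate`: TV of kernels under outer-tempered data),
af-pincer-Uc (onset ∕ AF split, kernel or `TensorizesAt` currency), ym19354-3 (block heat-bath Poincaré constant):
none uses maximal correlation across spherical shells or a multiplicative doubling law; the lever here is the pair
(static ρ*-mixing coefficient, `Ψ(2s+1) ≤ Ψ(s)²`).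

**bears_on:** LADDER-YM R2c · leaf `Summit.QuantumFields.YangMills.Theses.BalabanLadder.IR` (stmt-QuantumFields-19354).
**Honesty.** Nothing here proves the Clay YM mass gap; `stub_shellCert` IS the weak-coupling mass gap in
maximal-correlation clothes (one level stronger than `GapInUnits`, with a why-easier: threshold `θ < 1`, no datum);
R4 closes only the conditional finite-𝕋⁴ rung `BalabanLadder.UV`.
**Cheapest falsifier.** (F1, theory, run by the critic in one page) the massless lattice free field has `Ψ(s) → 1` as
`R → ∞` at fixed `s` (sphere-averaged modes: `1 − ρ² ≍ s/R`), the massive one has `sup_R Ψ(s) ≤ C e^{−ms}` (massive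
harmonic measure) — if the MASSIVE computation failed uniformly in `R` the certificate would be stronger than a gap and
the line dies; (F2, instrument, eng-2/eng-4) at strong coupling `Ψ_β(1)` vs the exact tiny-torus TM gap: the slab
analogue of `Ψ(s)` is `‖T^s|_{Ω⊥}‖`, so `−log Ψ(1) ≥ gap_TM` must hold on every lattice eng-2 can do (consistency row);
(F3, kernel) `#h21_crux_probe` on `IRShellCorr` / `ShellEngine` (must be CLEAN: not cheap, not vacuous, not `→ IR` by
`simpa`).

**MERGED LINE (director-ym R363, crit-2 MERGE; lead prover ym-ir-line-mxc-p1).**  This skeleton is the line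
«maximal correlation at one physical thickness» = `shell-maxcorr-doubling` (ideator ym-ir-idea-1) + the E-seam of
`collar-decoupling` (ideator ym-ir-idea-5, skeleton `Lines/collar_decoupling.lean` c706ce9c9222): §0 below carries the collar
line's vocabulary and its registered stub `stub_collarCriterion : CollarDecoupling.CollarCriterion` VERBATIM (same namespace, same
signature); the composition `IR_of` is the shell line's (`ShellEngine → IRShellCorr → BalabanLadder.IR`).  Registered stubs:
`stub_shellEngine` (M, lead), `stub_shellRung` (BC5 rung), `stub_collarCriterion` (E-seam), `stub_shellCert` (XL load — NOT staffed).

**COFINAL RE-CUT (lead g5, v8; director-ym №25 (2) after the leaf re-typing R423/R424, route rev 12):** the deciding leaf is now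
`Theses.BalabanLadder.IRcof` (stmt-QuantumFields-26930; the `GapInUnits` family owed only on SOME set of couplings unbounded above; this
item 19354 `IR` stays a supplier).  RE-PRICED: WALL UNCHANGED — the engine is PER-COUPLING (`abs_latticeConnectedCorr_le_exp_of_shellCert`,
`gapOn_of_shellCertOn`, p618715 `Theorems/IR/ShellMaxCorrCofinalEngine.lean`), so the merged line closes `IRcof` BY NAME modulo the COFINAL
load `IRShellCorrCof` (weaker than `IRShellCorr`: `shellCertCof_of_irShellCorr`) — companion skeleton `Lines/shell_maxcorr_doubling_cofinal.lean`
(one sorry; collar currency `CollarOnsetCof ⇒ IRShellCorrCof` by `shellCertOn_of_collarOnsetOn`).  Also landed: RUNG ∘ ENGINE end to end at strong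
coupling, `strongCoupling_clustering` (p619944 `Theorems/IR/ShellMaxCorrStrongCouplingClustering.lean`: every compact metrisable `G`, `|β| ≤ β₀(ρ)`,
all odd tori, `|⟨Aτ_nB⟩−⟨A⟩⟨B⟩| ≤ C(A,B) e^{−(log 2/6) n}` — OS78 Thm 3.5 clustering clause re-proved without cluster expansion; BC5 format
validation).  THIS file (old leaf `IR`, load of record `stub_shellCert`) is unchanged below.
**T1 TENSORISATION ENGINE LANDED (lead g4, p614395 + p615489 + p616789, v7):** idea-1 g0's support engine
`Cruxes/IR/Lines/tensorisation_engine.lean` — `Tensorisation.TensorisationEngine` (Witsenhausen 1975 Thm 1 / Kumar: maximal correlation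
of the JOINS of finitely many independent pair-σ-algebras ≤ the maximum over the pairs, operator format `MaxCorrLE`) — is the tree theorem
`Tensorisation.maxCorr_tensorisation_of_measurable` (`Theorems/IR/ShellMaxCorrTensorisation.lean`; parts `…TensorisationLaw` = two-block
Fubini lemma, `…TensorisationFormats` = covariance ⇔ operator format + transport by Doob–Dynkin; all-`f` form `maxCorr_tensorisation`);
the workfile's `stub_tensorisationEngine` is closed BY NAME (sorry-free).  Not a registered stub of this skeleton and not used by `IR_of`
(the rung was closed by Dobrushin–Poincaré): the line's THIRD certified radius-uniform maximal-correlation tool (doubling law, Dobrushin–Poincaré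
rung, tensorisation), banked.  Also v7: the collar typing `Lines/collar_decoupling.lean` is RE-BASED v2 (only sorry = its XL load) and idea-1 g3's
DA-chain plan `Lines/stub_shellRung_da_plan.lean` is sorry-free (plan stubs retired; target proved by another route).  Open after v7: unchanged —
ONLY the XL loads.
**COLLAR RUNG LANDED (lead g3, p610100 `Theorems/IR/CollarDecouplingRungSC.lean`, v6):** the collar typing's BC5 rung
`CollarDecoupling.stub_collarRungSC : CollarRungSC` (collar skeleton `Lines/collar_decoupling.lean` v1.1 third stub, typed at critic
ym-ir-crit-1's (4b) request: `∀` compact simple `G`, `r`, `∃ β_D > 0`, `∀ 0 < β ≤ β_D`, `CollarDecouplingAt r.ρ β 3`) is a tree theorem,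
via the W-GENERIC strong-coupling kernel-average surrogate `CollarDecoupling.exists_strongCoupling_surrogate` (g2's rung route for an
arbitrary finite link set + the Markov property of the torus weight specification); not a registered stub of this skeleton, recorded by
`example` below.  With it EVERY typed non-load statement of the merged line (shell engine, shell rung, collar E-seam, collar rung) and of
the pooled es-polymer line (rungs, refinement, engine) is a tree theorem; open: ONLY the XL loads `stub_shellCert : IRShellCorr` (here),
`stub_collarSharpOnset` (collar typing), `stub_polymerCertK` (es-polymer) — unstaffed per R366 (i).
**RUNG LANDED (lead g2, p596102 `Theorems/IR/ShellMaxCorrRung.lean`):** `stub_shellRung` is the tree theorem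
`ShellMaxCorr.stub_shellRung : ShellRung` — maximal correlation ≤ ½ across ONE layer at `|β| ≤ β₀(ρ)`, UNIFORM in the radius and the
torus, by the g2 route: Dobrushin ⇒ dimension-free Poincaré for the heat bath (`…ShellMaxCorrPoincare.lean`, p594109) + Bessel/Schur
bound on one-link boundary tilts (`…ShellMaxCorrTransfer.lean`, p595109; torus inputs `…BoundaryTilt` p594918, `…TorusCount` p595289,
`…TorusGram` p595658).  (g0's two-layer reduction p590708 `…RungReduction.lean` is not needed by the final proof.)  Open stubs now: ONLY the
unstaffed XL load `stub_shellCert`.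
**BRIDGE (lead, `Theorems/IR/ShellMaxCorrCollarBridge.lean`):** `CollarDecouplingAt ρ β b → ShellCert ρ β S (b+2) (1/2)` and collar onset ⇒
`ShellCertificate`, so the collar load implies the shell load `IRShellCorr` (the composition below covers both).
**E-SEAM LANDED (lead, p590240):** `stub_collarCriterion` is the tree theorem `CollarDecoupling.stub_collarCriterion`
(`Theorems/IR/CollarDecouplingCriterion.lean`); open stubs now: `stub_shellRung` (BC5 rung), `stub_shellCert` (unstaffed load).
**ENGINE LANDED (lead, p589320):** `stub_shellEngine` is the tree theorem `ShellMaxCorr.stub_shellEngine`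
(`Theorems/IR/ShellMaxCorrEngine.lean`, on `…Markov`, `…Doubling`, `…Supports`); open stubs: `stub_collarCriterion` (next),
`stub_shellRung`, `stub_shellCert` (unstaffed load).
**RE-BASED (lead, after p587133):** the vocabulary (§0 collar E-seam defs, §1–§3 shell defs, composition `ir_of_shell`) is now the
tree module `Summits/QuantumFields/YangMills/Theorems/IR/ShellMaxCorrDefs.lean`; this skeleton is `import` + the four registered
stubs + `IR_of := ir_of_shell stub_shellEngine stub_shellCert`.
-/
set_option autoImplicit false

noncomputable section

open Filter Topology MeasureTheory
open Literature.MathematicalPhysics.QuantumFieldTheory Literature.MathematicalPhysics.QuantumLattice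
open Summit.QuantumFields.YangMills.Cruxes.OSLegsFromFemtoAndGap.DlrCollarTransfer (GapInUnits LowerBounds)

-- E-seam `CollarDecoupling.stub_collarCriterion : CollarCriterion`: LANDED (p590240,
-- `Theorems/IR/CollarDecouplingCriterion.lean`, on `Theorems/IR/CollarDecouplingNest.lean`), imported.

namespace Summit.QuantumFields.YangMills.Cruxes.IR.ShellMaxCorr

-- stub 1 — THE ENGINE `stub_shellEngine : ShellEngine`: LANDED (p589320, `Theorems/IR/ShellMaxCorrEngine.lean`), imported.

/-- stub 2 — THE LOAD (R2c in maximal-correlation form; simplicity of `G` load-bearing; XL, NOT staffed). -/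
theorem stub_shellCert : IRShellCorr := by
  sorry

-- stub 3 — BC5 FORMAT RUNG `stub_shellRung : ShellRung`: LANDED (p596102, `Theorems/IR/ShellMaxCorrRung.lean`), imported
-- (tree theorem `Summit.QuantumFields.YangMills.Cruxes.IR.ShellMaxCorr.stub_shellRung`; not used by `IR_of`).
example : ShellRung := stub_shellRung

-- collar typing's BC5 RUNG `CollarDecoupling.stub_collarRungSC : CollarRungSC`: LANDED (lead g3, p610100,
-- `Theorems/IR/CollarDecouplingRungSC.lean`), imported (not a registered stub of this skeleton; not used by `IR_of`).
example : CollarDecoupling.CollarRungSC := CollarDecoupling.stub_collarRungSC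

/-- **The line concludes the route decl BY NAME:** `ShellEngine → IRShellCorr → BalabanLadder.IR` (tree `ir_of_shell`). -/
theorem IR_of : Summit.QuantumFields.YangMills.Theses.BalabanLadder.IR :=
  ir_of_shell stub_shellEngine stub_shellCert

end Summit.QuantumFields.YangMills.Cruxes.IR.ShellMaxCorr

end
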